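/-
Copyright (c) 2026. All rights reserved.
Released under Apache 2.0 license as described in the file LICENSE.
-/
import Mathlib.Logic.Equiv.Fin.Basic
import Literature.Computability.Complexity.CircuitComposition
import Literature.Computability.AlgebraicComplexity.DefinableVNPWitness

/-!
# Round circuits: outputs as gates, padding, positional layout

Stage S4c-i of the O-L2-14 isolation series (the plumbing half of
[cite: FennerGurjarThierauf2016, Section 3.2]: the weight functions of the rounds are juxtaposed in
one circuit whose binary read-out is their carry-free positional combination). Everything is over a
generic input type `ι`; the door `SuccinctTablesValiantCriterion` instantiates `ι` with the exponent
bits `Fin n × Fin (kBits n)` in S4c-ii.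

* §1 OUTPUTS BECOME GATES `exists_circuit_transcript`: a multi-output straight-line `B₂`-program
  (`CktSize B2 f s`, outputs = wires) becomes ONE `Circuit` with `J` designated GATES
  `out : Fin J → Fin Q.size` carrying the outputs in its `trueTranscript` — one copy gate per output
  (`copyProg`), appended with `GateList.vals_append_reloc`; this is the currency of the door's
  `weightOf Q out`.
* §2 PADDING `padBits`: an `ℓ`-bit output padded with zeros to a fixed width (`cktSize_padBits`,
  one constant gate) reads the same number (`ofBits_padBits`).
* §3 LAYOUT `layout`: `T` blocks of width `B`, block `0` most significant; sizes add
  (`cktSize_blocks`, `cktSize_layout`) and the read-out is `Σ_t ofBits(block t) · 2^{B (T-1-t)}`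
  (`ofBits_layout`).
* §4 HEADLINE `exists_circuit_ofBits_eq_sum`: §3 through §1.
Currency: kernel-certified helper for the W4 isolation road (stage S4c-i); closes no item; three
data defs (`copyProg`, `padBits`, `layout`), no facts, no doors.
-/

set_option linter.dupNamespace false

namespace Summit.ValiantsHypothesis.ValiantsHypothesis.Theorems.RoundCircuits

open Literature.Computability.Complexity Literature.Computability.Complexity.GateList
  Literature.Computability.AlgebraicComplexity CircuitArith BoolGadgets

variable {ι : Type*}

/-! ### §1 Outputs become gates: the copy layer and the transcript bridge -/

/-- The copy program on `J` inputs: gate `j` is the identity gate reading input wire `j`.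
[folklore] -/
def copyProg (J : ℕ) : List (Gate (Fin J)) :=
  List.ofFn fun j : Fin J => ⟨1, fun v => v 0, fun _ => Sum.inl j⟩

/-- A program whose gates read only input wires evaluates gate by gate. [folklore] -/
theorem vals_of_forall_args_inl (gs : List (Gate ι))
    (h : ∀ g ∈ gs, ∀ a, ∃ i, g.args a = Sum.inl i) (x : ι → Bool) :
    vals gs x = gs.map fun g => g.op fun a => wireOf x [] (g.args a) := by
  induction gs using List.reverseRecOn with
  | nil => rfl
  | append_singleton gs g ih =>
    rw [vals_append_singleton, ih fun g' hg' => h g' (List.mem_append_left _ hg'),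
      List.map_append, List.map_singleton]
    congr 2
    refine congrArg g.op (funext fun a => ?_)
    obtain ⟨i, hi⟩ := h g (List.mem_append_right _ (List.mem_singleton_self g)) a
    rw [hi, wireOf_inl, wireOf_inl]

/-- The copy program is well formed (it reads only inputs). [folklore] -/
theorem wf_copyProg (J : ℕ) : WF (copyProg J) := by
  intro j g hj a m ha
  simp only [copyProg, List.getElem?_ofFn] at hj
  by_cases h : j < J
  · rw [dif_pos h] at hj
    obtain rfl := Option.some.inj hj
    simp at ha
  · rw [dif_neg h] at hj
    exact absurd hj (by simp)

/-- The copy program outputs its inputs. [folklore] -/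
theorem vals_copyProg (J : ℕ) (y : Fin J → Bool) : vals (copyProg J) y = List.ofFn y := by
  rw [vals_of_forall_args_inl (copyProg J) _ y, copyProg, List.map_ofFn]
  · rfl
  · intro g hg a
    simp only [copyProg, List.mem_ofFn] at hg
    obtain ⟨j, rfl⟩ := hg
    exact ⟨j, rfl⟩

/-- The true transcript reads the gate values. [folklore] -/
theorem trueTranscript_eq_getD (Q : Circuit ι) (x : ι → Bool) (j : Fin Q.size) :
    trueTranscript Q x j = (vals Q.gates x).getD j false := by
  rw [← circuit_wireVals, wireVals_eq_transcript, ← ofFn_trueTranscript]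
  simp [j.isLt]

/-- **Bridge to the door's currency.** A multi-output straight-line `B₂`-program of size `≤ s`
becomes ONE `Circuit` with `J` designated GATES carrying the outputs (one copy gate per output).
[cite: Vollmer1999, §1.2] -/
theorem exists_circuit_transcript (i₀ : ι) {J s : ℕ} {f : (ι → Bool) → Fin J → Bool}
    (h : CktSize B2 f s) :
    ∃ (Q : Circuit ι) (out : Fin J → Fin Q.size), Q.IsOver B2 ∧ Q.size ≤ s + J ∧
      ∀ x j, trueTranscript Q x (out j) = f x j := by
  obtain ⟨gs, out, hl, hR⟩ := h
  have hwf : WF (gs ++ (copyProg J).map (reloc out gs.length)) :=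
    hR.wf.append_reloc (wf_copyProg J) hR.outOK
  let Q : Circuit ι := ⟨gs ++ (copyProg J).map (reloc out gs.length), Sum.inl i₀,
    fun j hj a m ha => hwf j _ (List.getElem?_eq_getElem hj) a m ha, fun m hm => by cases hm⟩
  have hQ : Q.size = gs.length + J := by
    show (gs ++ (copyProg J).map (reloc out gs.length)).length = _
    simp [copyProg]
  refine ⟨Q, fun j => ⟨gs.length + j, by rw [hQ]; have := j.isLt; omega⟩, ?_, by rw [hQ]; omega,
    fun x j => ?_⟩
  · intro g hg
    rcases List.mem_append.1 hg with h | h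
    · exact hR.isOver g h
    · obtain ⟨g', hg', rfl⟩ := List.mem_map.1 h
      simp only [copyProg, List.mem_ofFn] at hg'
      obtain ⟨j, rfl⟩ := hg'
      simp [B2, Gate.fn, reloc]
  · rw [trueTranscript_eq_getD]
    show (vals (gs ++ (copyProg J).map (reloc out gs.length)) x).getD (gs.length + j) false = _
    rw [vals_append_reloc gs (copyProg J) out hR.outOK x, vals_copyProg,
      List.getD_eq_getElem?_getD, List.getElem?_append_right (by simp), length_vals,
      Nat.add_sub_cancel_left, List.getElem?_ofFn, dif_pos j.isLt]
    simpa using hR.eval x j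

/-! ### §2 Padding a bit vector with zeros -/

/-- Pad an `ℓ`-bit output to `L` bits with `false`. [folklore] -/
def padBits (L : ℕ) {ℓ : ℕ} (f : (ι → Bool) → Fin ℓ → Bool) : (ι → Bool) → Fin L → Bool :=
  fun x i => if h : (i : ℕ) < ℓ then f x ⟨i, h⟩ else false

/-- Padding costs one constant gate. [folklore] -/
theorem cktSize_padBits (L : ℕ) {ℓ s : ℕ} {f : (ι → Bool) → Fin ℓ → Bool} (hf : CktSize B2 f s) :
    CktSize B2 (padBits L f) (1 + s) :=
  (((cktSize_const ι false).pair hf).outMap fun i : Fin L =>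
      if h : (i : ℕ) < ℓ then Sum.inr ⟨i, h⟩ else Sum.inl ()).congr fun x i => by
    unfold padBits
    by_cases h : (i : ℕ) < ℓ <;> simp [h]

/-- Padding does not change the number read in binary. [folklore] -/
theorem ofBits_padBits {L ℓ : ℕ} (hℓ : ℓ ≤ L) (f : (ι → Bool) → Fin ℓ → Bool) (x : ι → Bool) :
    Nat.ofBits (padBits L f x) = Nat.ofBits (f x) := by
  refine Nat.eq_of_testBit_eq fun i => ?_
  rw [Nat.testBit_ofBits, Nat.testBit_ofBits]
  unfold padBits
  by_cases h1 : i < ℓ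
  · rw [dif_pos (lt_of_lt_of_le h1 hℓ), dif_pos h1]
  · by_cases h2 : i < L
    · rw [dif_pos h2, dif_neg h1]
    · rw [dif_neg h2, dif_neg h1]

/-! ### §3 Positional layout of `T` blocks of width `B` (block `0` most significant) -/

/-- Bit `i + B·a` of the layout is bit `i` of block `T-1-a`. [folklore] -/
def layout {T B : ℕ} (fs : Fin T → (ι → Bool) → Fin B → Bool) : (ι → Bool) → Fin (T * B) → Bool :=
  fun x j => fs (Fin.rev (finProdFinEquiv.symm j).1) x (finProdFinEquiv.symm j).2

/-- Bundling `T` multi-output programs on the same inputs (outputs `Fin T × κ`): sizes add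
(`Uhlig.cktSize_prodPi_fin` of `MassProduction`, restated because that module is outside this
file's import closure). [cite: Vollmer1999, §1.2] -/
theorem cktSize_blocks {κ : Type*} {T s₀ : ℕ} {fs : Fin T → (ι → Bool) → κ → Bool}
    (h : ∀ t, CktSize B2 (fs t) s₀) :
    CktSize B2 (fun x (tk : Fin T × κ) => fs tk.1 x tk.2) (T * s₀) := by
  induction T with
  | zero =>
    haveI : IsEmpty (Fin 0 × κ) := by infer_instance
    exact (CktSize.of_isEmpty B2 _).of_le (Nat.zero_le _)
  | succ T ih =>
    have h1 := (ih fun t => h t.castSucc).pair (h (Fin.last T))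
    rw [add_one_mul]
    refine (h1.outMap fun tk : Fin (T + 1) × κ =>
      if ht : (tk.1 : ℕ) < T then Sum.inl (⟨tk.1, ht⟩, tk.2) else Sum.inr tk.2).congr fun x tk => ?_
    obtain ⟨t, k⟩ := tk
    by_cases ht : (t : ℕ) < T
    · simp only [ht, ↓reduceDIte, Sum.elim_inl]
      rfl
    · simp only [ht, ↓reduceDIte, Sum.elim_inr]
      rw [Fin.eq_last_of_not_lt ht]

/-- The layout is the bundle of the block programs: sizes add. [cite: Vollmer1999, §1.2] -/
theorem cktSize_layout {T B s₀ : ℕ} {fs : Fin T → (ι → Bool) → Fin B → Bool}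
    (h : ∀ t, CktSize B2 (fs t) s₀) : CktSize B2 (layout fs) (T * s₀) :=
  ((cktSize_blocks h).outMap fun j : Fin (T * B) =>
    (Fin.rev (finProdFinEquiv.symm j).1, (finProdFinEquiv.symm j).2)).congr fun _ _ => rfl

/-- The layout read in binary is the positional combination `Σ_t ofBits(block t) · 2^{B(T-1-t)}`.
[folklore] -/
theorem ofBits_layout {T B : ℕ} (fs : Fin T → (ι → Bool) → Fin B → Bool) (x : ι → Bool) :
    Nat.ofBits (layout fs x) = ∑ t : Fin T, Nat.ofBits (fs t x) * 2 ^ (B * (T - 1 - ↑t)) := by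
  have h1 : Nat.ofBits (layout fs x) =
      ∑ a : Fin T, Nat.ofBits (fs (Fin.rev a) x) * 2 ^ (B * ↑a) := by
    rw [ofBits_eq_sum, ← Equiv.sum_comp finProdFinEquiv, Fintype.sum_prod_type]
    refine Finset.sum_congr rfl fun a _ => ?_
    rw [ofBits_eq_sum, Finset.sum_mul]
    refine Finset.sum_congr rfl fun i _ => ?_
    simp only [layout, Equiv.symm_apply_apply, finProdFinEquiv_apply_val, pow_add]
    ring
  rw [h1, ← Equiv.sum_comp Fin.revPerm]
  refine Finset.sum_congr rfl fun t _ => ?_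
  simp only [Fin.revPerm_apply, Fin.rev_rev, Fin.val_rev]
  congr 3
  omega

/-! ### §4 HEADLINE of S4c-i -/

/-- **S4c-i HEADLINE — juxtaposed round circuits.** `T` width-`B` programs of size `≤ s₀` each give
ONE `B₂`-circuit with `T·B` designated gates whose binary read-out is
`Σ_t ofBits(f_t x) 2^{B(T-1-t)}`. [cite: FennerGurjarThierauf2016, Section 3.2] -/
theorem exists_circuit_ofBits_eq_sum (i₀ : ι) {T B s₀ : ℕ} (fs : Fin T → (ι → Bool) → Fin B → Bool)
    (h : ∀ t, CktSize B2 (fs t) s₀) :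
    ∃ (Q : Circuit ι) (out : Fin (T * B) → Fin Q.size), Q.IsOver B2 ∧ Q.size ≤ T * s₀ + T * B ∧
      ∀ x, Nat.ofBits (fun j => trueTranscript Q x (out j)) =
        ∑ t : Fin T, Nat.ofBits (fs t x) * 2 ^ (B * (T - 1 - ↑t)) := by
  obtain ⟨Q, out, hQ, hs, hval⟩ := exists_circuit_transcript i₀ (cktSize_layout h)
  refine ⟨Q, out, hQ, hs, fun x => ?_⟩
  have hf : (fun j => trueTranscript Q x (out j)) = layout fs x := funext (hval x)
  rw [hf, ofBits_layout]

end Summit.ValiantsHypothesis.ValiantsHypothesis.Theorems.RoundCircuits
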